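import Mathlib.Analysis.Calculus.ContDiff.Basic
import Mathlib.Analysis.Calculus.IteratedDeriv.Defs
import Mathlib.LinearAlgebra.Matrix.PosDef
import Literature.Probability.LatticeModels.BattleFederbushTrees
import Literature.MeasureTheory.Integral.PolynomialCubeIntegral
import HarnessLib

/-!
# Crux `AnchorGap` (stmt-QuantumFields-11141), line `registered` — stub GBND

The registered generic stub `stub_bbfActivityTreeBound` of `Cruxes/AnchorGap/Lines/birth.lean`:
the activity `K X` of the Gaussian Battle–Brydges–Federbush polymer representation (GREP) is
bounded by `M |∏ Z1|⁻¹` times the anchored-tree sum `Σ_{T ∈ lineSets (min X) X} ∏_{ℓ∈T} y_ℓ` as soon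
as every script's interpolated expectation is bounded by `M ∏_{lines} y_ℓ` — by REGROUPING THE
SCRIPTS BY THEIR ANCHORED TREE, the scripts traversing the same tree having total weight
`Σ_{s ↦ T} ∫ w_s = 1` (Mastropietro 2008, Lemma 2.3 = the tree's
`BattleFederbush.Script.sum_cubeIntegral_weight_eq_one`).  The Gaussian objects of GREP (`cov`,
`E`, `Dop`, `Z1`, `G`) enter only through the displayed hypothesis: the content is the abstract
regrouping `TreeBound.abs_sum_scripts_setIntegral_le` for ANY script contributions `F_s(t)` with
`|F_s| ≤ M ∏_{lines(s)} y` on the cube.  [folklore] real analysis over the tree's script vocabulary;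
no definition, no named fact.

* `TreeBound.eval_weight_nonneg`, `TreeBound.abs_setIntegral_weight_mul_le` — `w_s ≥ 0` on
  `[0,1]^β`, so `|∫ w_s F| ≤ P ∫ w_s` when `|F| ≤ P` (`norm_integral_le_of_norm_le`,
  `cubeIntegral_eq_setIntegral`);
* `TreeBound.prod_map_lines_eq` — the lines of a valid script are distinct (`Script.nodup_lines`);
* `TreeBound.sum_scripts_prod_mul_cubeIntegral_eq` — the regrouping identity
  `Σ_k Σ_{s valid, pts X} (∏_{lines(s)} y) ∫ w_s = Σ_{T ∈ lineSets v X} ∏_{ℓ∈T} y_ℓ`;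
* `TreeBound.abs_sum_scripts_setIntegral_le` — the abstract bound; `stub_bbfActivityTreeBound`.
-/

set_option autoImplicit false

namespace Summit.QuantumFields.YangMills.Theorems.AnchorGap

namespace TreeBound

open Finset MeasureTheory MvPolynomial Literature.MeasureTheory.Integral
  Literature.Probability.LatticeModels Literature.Probability.LatticeModels.BattleFederbush

variable {β : Type} [Fintype β] [DecidableEq β]

omit [Fintype β] in
/-- The real interpolation weight `w_s(t) = ∏ t_i^{e_i}` is nonnegative on the unit cube.
[folklore] -/
theorem eval_weight_nonneg {v : β} {k : ℕ} (s : Script v k) {t : β → ℝ} (ht : t ∈ unitCube β) :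
    0 ≤ eval t (Script.weight ℝ s) := by
  rw [Script.weight, eval_monomial, one_mul, Finsupp.prod]
  exact Finset.prod_nonneg fun i _ => pow_nonneg ((mem_unitCube.1 ht) i).1 _

omit [DecidableEq β] in
/-- The unit cube is measurable. [folklore] -/
theorem measurableSet_unitCube' : MeasurableSet (unitCube β) :=
  MeasurableSet.univ_pi fun _ => measurableSet_Icc

/-- **One script**: `|∫_{[0,1]^β} w_s(t) F(t) dt| ≤ P · ∫ w_s` when `|F| ≤ P` on the cube (the
weight is nonnegative there). [folklore] -/
theorem abs_setIntegral_weight_mul_le {v : β} {k : ℕ} (s : Script v k) (F : (β → ℝ) → ℝ) {P : ℝ}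
    (hF : ∀ t ∈ unitCube β, |F t| ≤ P) :
    |∫ t in unitCube β, eval t (Script.weight ℝ s) * F t|
      ≤ P * Literature.RingTheory.MvPolynomial.cubeIntegral β ℝ (Script.weight ℝ s) := by
  have hint : IntegrableOn (fun t : β → ℝ => eval t (Script.weight ℝ s)) (unitCube β) := by
    simpa using integrableOn_eval_unitCube (𝕜 := ℝ) (Script.weight ℝ s)
  have hcube : Literature.RingTheory.MvPolynomial.cubeIntegral β ℝ (Script.weight ℝ s)
      = ∫ t in unitCube β, eval t (Script.weight ℝ s) := by
    simpa using cubeIntegral_eq_setIntegral (𝕜 := ℝ) (Script.weight ℝ s)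
  rw [hcube, ← integral_const_mul]
  refine (Real.norm_eq_abs _).symm.trans_le (norm_integral_le_of_norm_le (hint.const_mul P) ?_)
  refine (ae_restrict_iff' measurableSet_unitCube').2 (Filter.Eventually.of_forall fun t ht => ?_)
  rw [Real.norm_eq_abs, abs_mul, abs_of_nonneg (eval_weight_nonneg s ht), mul_comm P]
  exact mul_le_mul_of_nonneg_left (hF t ht) (eval_weight_nonneg s ht)


omit [Fintype β] in
/-- For a valid script the line-weight product over the LIST of its lines is the product over its
line SET (the lines of a valid script are distinct, `Script.nodup_lines`). [folklore] -/
theorem prod_map_lines_eq {v : β} {k : ℕ} (s : Script v k) (hs : s.Valid) (y : Sym2 β → ℝ) :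
    (s.lines.map y).prod = ∏ ℓ ∈ s.lines.toFinset, y ℓ :=
  (List.prod_toFinset y (Script.nodup_lines s hs)).symm

/-- **Regrouping the scripts by their anchored tree** (Mastropietro 2008, Lemma 2.3 in use): if
every valid script `s` rooted at `v` with point set `X` carries a contribution `c_s` weighted by
`∏_{lines} y`, then `Σ_k Σ_{s valid, pts = X} (∏_{lines(s)} y) · ∫ w_s = Σ_{T ∈ lineSets v X} ∏_{ℓ∈T} y_ℓ`
— the scripts traversing the same tree have total weight `Σ_{s ↦ T} ∫ w_s = 1`
(`Script.sum_cubeIntegral_weight_eq_one`). [cite: Mastropietro2008, Lemma 2.3 (2.102)] -/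
theorem sum_scripts_prod_mul_cubeIntegral_eq (v : β) (X : Finset β) (y : Sym2 β → ℝ) :
    ∑ k ∈ range (Fintype.card β), ∑ s : Script v k,
        (if s.Valid ∧ univ.image s.y = X then
          (s.lines.map y).prod * Literature.RingTheory.MvPolynomial.cubeIntegral β ℝ (Script.weight ℝ s)
         else 0)
      = ∑ T ∈ lineSets v X, ∏ ℓ ∈ T, y ℓ := by
  classical
  -- spread each script over the line sets (exactly one matches)
  have hpt : ∀ k ∈ range (Fintype.card β), ∀ s : Script v k,
      (if s.Valid ∧ univ.image s.y = X then
          (s.lines.map y).prod * Literature.RingTheory.MvPolynomial.cubeIntegral β ℝ (Script.weight ℝ s)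
        else 0)
        = ∑ T ∈ lineSets v X, (if s.Valid ∧ s.lines.toFinset = T then
            (∏ ℓ ∈ T, y ℓ) * Literature.RingTheory.MvPolynomial.cubeIntegral β ℝ (Script.weight ℝ s)
            else 0) := by
    intro k hk s
    by_cases hs : s.Valid
    · by_cases hX : univ.image s.y = X
      · rw [if_pos ⟨hs, hX⟩]
        have hmem : s.lines.toFinset ∈ lineSets v X :=
          mem_lineSets.2 ⟨k, mem_range.1 hk, s, hs, hX, rfl⟩
        simp only [hs, true_and]
        rw [Finset.sum_ite_eq (lineSets v X) s.lines.toFinset, if_pos hmem, prod_map_lines_eq s hs]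
      · rw [if_neg (fun h => hX h.2)]
        symm
        refine sum_eq_zero fun T hT => ?_
        rw [if_neg]
        rintro ⟨-, hT'⟩
        obtain ⟨k', -, s', hs', hX', hT''⟩ := mem_lineSets.1 hT
        exact hX ((Script.image_y_eq_of_lines_eq s s' (hT'.trans hT''.symm)).trans hX')
    · rw [if_neg (fun h => hs h.1)]
      symm
      exact sum_eq_zero fun T _ => if_neg (fun h => hs h.1)
  rw [sum_congr rfl fun k hk => sum_congr rfl fun s _ => hpt k hk s]
  -- swap the sums and use Lemma 2.3 tree by tree
  rw [sum_congr rfl fun k _ => Finset.sum_comm, Finset.sum_comm]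
  refine sum_congr rfl fun T hT => ?_
  obtain ⟨k₀, -, s₀, hs₀, -, rfl⟩ := mem_lineSets.1 hT
  have h1 := Script.sum_cubeIntegral_weight_eq_one (R := ℝ) s₀ hs₀
  calc ∑ k ∈ range (Fintype.card β), ∑ s : Script v k,
        (if s.Valid ∧ s.lines.toFinset = s₀.lines.toFinset then
          (∏ ℓ ∈ s₀.lines.toFinset, y ℓ) *
            Literature.RingTheory.MvPolynomial.cubeIntegral β ℝ (Script.weight ℝ s) else 0)
      = (∏ ℓ ∈ s₀.lines.toFinset, y ℓ) * ∑ k ∈ range (Fintype.card β), ∑ s : Script v k,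
          (if s.Valid ∧ s.lines.toFinset = s₀.lines.toFinset then
            Literature.RingTheory.MvPolynomial.cubeIntegral β ℝ (Script.weight ℝ s) else 0) := by
        rw [mul_sum]
        refine sum_congr rfl fun k _ => ?_
        rw [mul_sum]
        refine sum_congr rfl fun s _ => ?_
        split_ifs <;> simp
    _ = ∏ ℓ ∈ s₀.lines.toFinset, y ℓ := by rw [h1, mul_one]

/-- **The activity bound by regrouping (abstract GBND).** If the contribution `F_s(t)` of every
valid script `s` rooted at `v` with point set `X` satisfies `|F_s(t)| ≤ M ∏_{lines(s)} y` on the cube,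
then `|Σ_k Σ_{s valid, pts = X} ∫_{[0,1]^β} w_s F_s| ≤ M · Σ_{T ∈ lineSets v X} ∏_{ℓ∈T} y_ℓ`.
[cite: Mastropietro2008, Lemma 2.3 (2.102)] -/
theorem abs_sum_scripts_setIntegral_le (v : β) (X : Finset β)
    (F : (k : ℕ) → Script v k → (β → ℝ) → ℝ) (y : Sym2 β → ℝ) (M : ℝ)
    (hF : ∀ (k : ℕ) (s : Script v k), s.Valid → univ.image s.y = X →
      ∀ t ∈ unitCube β, |F k s t| ≤ M * (s.lines.map y).prod) :
    |∑ k ∈ range (Fintype.card β), ∑ s : Script v k,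
        (if s.Valid ∧ univ.image s.y = X then
          ∫ t in unitCube β, eval t (Script.weight ℝ s) * F k s t else 0)|
      ≤ M * ∑ T ∈ lineSets v X, ∏ ℓ ∈ T, y ℓ := by
  classical
  rw [← sum_scripts_prod_mul_cubeIntegral_eq v X y, mul_sum]
  refine (abs_sum_le_sum_abs _ _).trans (sum_le_sum fun k _ => ?_)
  rw [mul_sum]
  refine (abs_sum_le_sum_abs _ _).trans (sum_le_sum fun s _ => ?_)
  by_cases h : s.Valid ∧ univ.image s.y = X
  · rw [if_pos h, if_pos h, ← mul_assoc]
    exact abs_setIntegral_weight_mul_le s (F k s) (hF k s h.1 h.2)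
  · rw [if_neg h, if_neg h, abs_zero, mul_zero]

end TreeBound

open scoped Matrix

open MeasureTheory Literature.Probability.LatticeModels in
/-- **Stub GBND (GENERIC; M — grouping the scripts of GREP's activity by their tree).** In the setting of
GREP, if for every valid script with point set `X` and every cube parameter the interpolated expectation
of the line-differentiated product is bounded by `M · Π_{lines} y_ℓ` (`y ≥ 0` line weights), then
`|K X| ≤ M |Π_{b∈X} Z1_b|⁻¹ Σ_{T ∈ lineSets(min X) X} Π_{ℓ∈T} y_ℓ` — the scripts traversing the same anchored
tree have total weight `Σ_{s↦T} ∫w_s = 1`.  Proof: the Gaussian objects `cov, E, Dop, G` enter only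
through the displayed hypothesis; `|∫_{[0,1]^β} w_s F_s| ≤ (M ∏_{lines(s)} y) ∫ w_s` script by script
(`w_s ≥ 0` on the cube, `norm_integral_le_of_norm_le`, `cubeIntegral_eq_setIntegral`), the lines of a
valid script are distinct (`Script.nodup_lines`), and regrouping by the line set
(`TreeBound.sum_scripts_prod_mul_cubeIntegral_eq`) uses `Script.sum_cubeIntegral_weight_eq_one`
(Mastropietro 2008, Lemma 2.3) tree by tree. [cite: Mastropietro2008, Lemma 2.3 (2.102)] -/
theorem stub_bbfActivityTreeBound :
    ∀ (ι β : Type) [Fintype ι] [DecidableEq ι] [Fintype β] [DecidableEq β] [LinearOrder β] (blk : ι → β) (C : Matrix ι ι ℝ), C.PosDef → ∀ (G : β → (ι → ℝ) → ℝ), (∀ b : β, ContDiff ℝ (⊤ : ℕ∞) (G b)) → (∀ (b : β) (n : ℕ), ∃ (K : ℝ) (m : ℕ), ∀ φ : ι → ℝ, ‖iteratedFDeriv ℝ n (G b) φ‖ ≤ K * (1 + ∑ i, φ i ^ 2) ^ m) → (∀ (b : β) (φ ψ : ι → ℝ), (∀ i : ι, blk i = b → φ i = ψ i) → G b φ = G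 b ψ) → let cov : Finset β → (Sym2 β → ℝ) → Matrix ι ι ℝ := fun X σ => Matrix.of fun i j : ι => (if blk i = blk j then 1 else if blk i ∈ X ∧ blk j ∈ X then σ s(blk i, blk j) else 0) * C i j; let E : Matrix ι ι ℝ → ((ι → ℝ) → ℝ) → ℝ := fun Cv H => (∫ φ : ι → ℝ, H φ * Real.exp (-(φ ⬝ᵥ (Cv⁻¹ *ᵥ φ)) / 2)) / ∫ φ : ι → ℝ, Real.exp (-(φ ⬝ᵥ (Cv⁻¹ *ᵥ φ)) / 2); let Dop : Sym2 β → ((ι → ℝ) → ℝ) → ((ι → ℝ) → ℝ) := fun ℓ H φ => (1 / 2 : ℝ) * ∑ x : ι, ∑ y : ι, if s(blk x, blk y) = ℓ ∧ blk x ≠ blk y then C x y * iteratedFDeriv ℝ 2 H φ ![Pi.single x 1, Pi.single y 1] else 0; let Z1 : β → ℝ := fun b => E (cov ∅ fun _ => 0) (G b); (∀ b : β, Z1 b ≠ 0) → let K : Finset β → ℝ := fun X => if hX : 2 ≤ X.card then (∑ k ∈ Finset.range (Fintype.card β), ∑ s : BattleFederbush.Script (X.min' (Finset.card_pos.mp (lt_of_lt_of_le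 Nat.zero_lt_two hX))) k, if s.Valid ∧ Finset.univ.image s.y = X then ∫ t in Literature.MeasureTheory.Integral.unitCube β, MvPolynomial.eval t (BattleFederbush.Script.weight ℝ s) * E (cov X fun ℓ => MvPolynomial.eval t (BattleFederbush.Script.decPt ℝ s ℓ)) (s.lines.foldl (fun H ℓ => Dop ℓ H) fun φ => ∏ b ∈ X, G b φ) else 0) / ∏ b ∈ X, Z1 b else 0; ∀ (y : Sym2 β → ℝ), (∀ ℓ : Sym2 β, 0 ≤ y ℓ) → ∀ (X : Finset β) (hX2 : 2 ≤ X.card) (M : ℝ), 0 ≤ M → (∀ (k : ℕ) (s : BattleFederbush.Script (X.min' (Finset.card_pos.mp (lt_of_lt_of_le Nat.zero_lt_two hX2))) k), s.Valid → Finset.univ.image s.y = X → ∀ t ∈ Literature.MeasureTheory.Integral.unitCube β, |E (cov X fun ℓ => MvPolynomial.eval t (BattleFederbush.Script.decPt ℝ s ℓ)) (s.lines.foldl (fun H ℓ => Dop ℓ H) fun φ => ∏ b ∈ X, G b φ)| ≤ M * (s.lines.map y).prod) → |K X| ≤ M * |(∏ b ∈ X, Z1 b)⁻¹| * ∑ T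 ∈ BattleFederbush.lineSets (X.min' (Finset.card_pos.mp (lt_of_lt_of_le Nat.zero_lt_two hX2))) X, ∏ ℓ ∈ T, y ℓ := by
  intro ι β _ _ _ _ _ blk C hC G hG1 hG2 hG3 cov E Dop Z1 hZ1 K y hy X hX2 M hM hb
  have hK : K X = (∑ k ∈ Finset.range (Fintype.card β),
      ∑ s : BattleFederbush.Script (X.min' (Finset.card_pos.mp (lt_of_lt_of_le Nat.zero_lt_two hX2))) k,
        if s.Valid ∧ Finset.univ.image s.y = X then
          ∫ t in Literature.MeasureTheory.Integral.unitCube β,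
            MvPolynomial.eval t (BattleFederbush.Script.weight ℝ s) *
              E (cov X fun ℓ => MvPolynomial.eval t (BattleFederbush.Script.decPt ℝ s ℓ))
                (s.lines.foldl (fun H ℓ => Dop ℓ H) fun φ => ∏ b ∈ X, G b φ)
        else 0) / ∏ b ∈ X, Z1 b := by
    simp only [K, dif_pos hX2]
  rw [hK, abs_div, div_eq_mul_inv, ← abs_inv]
  have hmain := TreeBound.abs_sum_scripts_setIntegral_le
    (X.min' (Finset.card_pos.mp (lt_of_lt_of_le Nat.zero_lt_two hX2))) X
    (fun k s t => E (cov X fun ℓ => MvPolynomial.eval t (BattleFederbush.Script.decPt ℝ s ℓ))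
      (s.lines.foldl (fun H ℓ => Dop ℓ H) fun φ => ∏ b ∈ X, G b φ)) y M hb
  calc _ ≤ (M * ∑ T ∈ BattleFederbush.lineSets
          (X.min' (Finset.card_pos.mp (lt_of_lt_of_le Nat.zero_lt_two hX2))) X, ∏ ℓ ∈ T, y ℓ) *
          |(∏ b ∈ X, Z1 b)⁻¹| := mul_le_mul_of_nonneg_right hmain (abs_nonneg _)
    _ = _ := by ring

end Summit.QuantumFields.YangMills.Theorems.AnchorGap
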